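import Summits.CriticalPhenomena.CardyFormulaZ2.Theorems.CardyComplexConeEdgePrecompactUFRSMarkedDecayRectRows
import Summits.CriticalPhenomena.CardyFormulaZ2.Theorems.CardyComplexConeEdgePrecompactUFRSMarkedDecayRectMono

/-!
# UFRS, decay at the marked points (rectangles), part 7: the MARKED branch over the collar
(line `qkz-strip-boundary-arm` of crux `CardyComplexCone.EdgePrecompact`, stmt-CriticalPhenomena-11387;
support for the registered sub-goal `ufrs_markedPointDecay_rect`, wave 3 of lead c4)

`markedBranch_le_W3M` (registered): for an admissible datum `E` of an open rectangle `D`, a shift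
`w`, `0 < η ≤ ρ/4096` (and `4η` below the side lengths, `E.δ ≤ η/4`), given the flat three-strand
decay (`C_T`, `α`) and the junction two-strand decay (`C_J`, `β`) for `(E, w)`,
`P{ω | ∃ z ∈ D, infDist z Dᶜ < 3η ∧ ω ∈ ufrsCertMarked E w z (4η) (ρ/2)} ≤ 176 K L³ (η/ρ)^{min α β}`,
`L = log₂⌈ρ/η⌉ + 1`. COVER: a collar point `z` with certificate scales `d = ρ/4/2^k`,
`R' = ρ/8/2^{k'}` and a marked edge within `4R'` has a NEAREST marked edge `e₀` at distance
`u ≤ 4R'`, a dyadic class `U = η 2^a` (`u < 2U`, and `U ≤ u` unless `U = η`), all three indices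
`< L` (`lt_logCeil_W3M`), and a box centre `q` of one of the four rows within `3η`
(`near_side_W3M`, `grid_index_W3M`); monotonicity of `ufrsStrands` in centre and radii
(`ufrsStrands_mono_W3M`, `ufrsStrands_two_of_three_W3M`) puts `ω` in the per-box event of part 5 at
`(e₀, a, k, k', q)`. SUM: four marked edges, `L³` index triples, four rows each `≤ 11 K (η/ρ)^γ`
(`markedRow_le_W3M`).

References: G. F. Lawler, O. Schramm, W. Werner, Electron. J. Probab. 7 (2002), Appendix A;
S. Smirnov, C. R. Acad. Sci. Paris 333 (2001), §2.
-/

namespace Summit.CriticalPhenomena.CardyFormulaZ2.Cruxes.EdgePrecompact.QkzStripBoundaryArm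

open MeasureTheory Filter Set Metric
open scoped Topology BigOperators Pointwise
open Literature.Probability.LatticeModels Literature.Probability.Percolation
open Literature.Probability.RandomPlanarGeometry (DobrushinDomain)
open Summit.CriticalPhenomena.CardyFormulaZ2.Theses.CardyComplexCone

noncomputable section

/-! ## Part 9: the MARKED branch over the collar of a rectangle -/

/-- Distance in `ℂ` is at most the sum of the coordinate distances (private copy of a folklore
inequality landed elsewhere in the tree, to keep the import closure of the line small). -/
private theorem dist_le_re_add_im'_W3M (z w : ℂ) : dist z w ≤ |z.re - w.re| + |z.im - w.im| := by
  rw [Complex.dist_eq, ← Complex.sub_re, ← Complex.sub_im]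
  exact Complex.norm_le_abs_re_add_abs_im _

/-- Dyadic indices are logarithmically few: `2^t ≤ ρ/η` forces `t < log₂ ⌈ρ/η⌉ + 1`. -/
theorem lt_logCeil_W3M {ρ η : ℝ} (t : ℕ) (h : (2 : ℝ) ^ t ≤ ρ / η) : t < Nat.log 2 ⌈ρ / η⌉₊ + 1 := by
  have h1 : 2 ^ t ≤ ⌈ρ / η⌉₊ := by
    have := le_trans h (Nat.le_ceil (ρ / η))
    exact_mod_cast this
  have h2 := Nat.lt_pow_succ_log_self (b := 2) (by norm_num) ⌈ρ / η⌉₊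
  exact (Nat.pow_lt_pow_iff_right (by norm_num)).1 (lt_of_le_of_lt h1 h2)

set_option maxHeartbeats 1600000 in
/-- **Decay of the MARKED branch over the collar of a rectangle** (given the two bridges for the
datum `E`, shift `w`): covering the `3η`-collar by four rows of `η`-boxes along the sides,
classifying the collar point by its nearest marked edge `e₀`, the dyadic class `U = η 2^a` of its
distance to it and the certificate scales `d = ρ/4/2^k`, `R' = ρ/8/2^{k'}` (all indices
`< L = log₂⌈ρ/η⌉ + 1`), the MARKED event lies in the union of the per-box events of
`markedTerm_le_W3M` (monotonicity of `ufrsStrands` in centre and radii), whence by the row bound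
`markedRow_le_W3M`: probability `≤ 176 K L³ (η/ρ)^{min α β}`. -/
theorem markedBranch_le_W3M : ∀ {D : DobrushinDomain} {x₀ x₁ y₀ y₁ : ℝ}, D.carrier = Set.Ioo x₀ x₁ ×ℂ Set.Ioo y₀ y₁ → ∀ {E : DiscreteDobrushin} {w : Site 2} {η ρ CT α CJ β : ℝ}, E.IsZdAdmissible → E.δ ≤ η / 4 → (∀ (z : ℂ) (s S : ℝ), z ∈ D.carrier → infDist z D.carrierᶜ ≤ s → η ≤ s → 0 < S → (∀ e' : Sym2 (Site 2), (e' ∈ E.zdABEdges ∨ e' ∈ (shiftData E w).zdABEdges) → 2 * S ≤ dist (medialPoint E.δ e') z) → (bondPercolation (zdGraph 2) half).real (ufrsStrands E w z 3 s S) ≤ CT * (s / S) ^ (1 + α)) → (∀ e' : Sym2 (Site 2), (e' ∈ E.zdABEdges ∨ e' ∈ (shiftData E w).zdABEdges) → ∀ s S : ℝ, η ≤ s → 0 < S → (bondPercolation (zdGraph 2) half).real (ufrsStrands E w (medialPoint E.δ e') 2 s S) ≤ CJ * (s / S) ^ β) → 0 < η → η ≤ ρ / 4096 → 4 * η ≤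 x₁ - x₀ → 4 * η ≤ y₁ - y₀ → 0 < α → 0 < β → (bondPercolation (zdGraph 2) half).real {ω : BondConfig (Site 2) | ∃ z ∈ D.carrier, infDist z D.carrierᶜ < 3 * η ∧ ω ∈ ufrsCertMarked E w z (4 * η) (ρ / 2)} ≤ 176 * ((max CT 1) ^ 2 * (512 : ℝ) ^ (1 + α) * ((max CJ 1) ^ 3 * (262144 : ℝ) ^ β)) * ((Nat.log 2 ⌈ρ / η⌉₊ + 1 : ℕ) : ℝ) ^ 3 * (η / ρ) ^ min α β := by
  intro D x₀ x₁ y₀ y₁ hD E w η ρ CT α CJ β hE hδη hT hJ hη hηρ hηx hηy hα hβ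
  classical
  have hρ : 0 < ρ := by linarith
  set μ := bondPercolation (zdGraph 2) half with hμ
  set K : ℝ := (max CT 1) ^ 2 * (512 : ℝ) ^ (1 + α) * ((max CJ 1) ^ 3 * (262144 : ℝ) ^ β) with hK
  have hK0 : 0 ≤ K := by positivity
  set L : ℕ := Nat.log 2 ⌈ρ / η⌉₊ + 1 with hL
  set N₀ : ℕ := ⌊(x₁ - x₀) / η⌋₊ with hN₀
  set N₁ : ℕ := ⌊(y₁ - y₀) / η⌋₊ with hN₁
  set M := (finite_markedEdges_W3M hE w).toFinset with hM
  set p₀ : ℕ → ℂ := fun j => Complex.mk (x₀ + ((j : ℝ) + 1 / 2) * η) (y₀ + 3 * η / 2) with hp₀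
  set p₁ : ℕ → ℂ := fun j => Complex.mk (x₀ + ((j : ℝ) + 1 / 2) * η) (y₁ - 3 * η / 2) with hp₁
  set p₂ : ℕ → ℂ := fun j => Complex.mk (x₀ + 3 * η / 2) (y₀ + ((j : ℝ) + 1 / 2) * η) with hp₂
  set p₃ : ℕ → ℂ := fun j => Complex.mk (x₁ - 3 * η / 2) (y₀ + ((j : ℝ) + 1 / 2) * η) with hp₃
  obtain ⟨G, hG⟩ : ∃ G : Sym2 (Site 2) → ℕ → ℕ → ℕ → ℂ → Set (BondConfig (Site 2)), G = fun e₀ a k k' q =>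
    {ω : BondConfig (Site 2) |
      (dist q (medialPoint E.δ e₀) ≤ 2 * (η * 2 ^ a) + 3 * η ∧ η * 2 ^ a ≤ 4 * (ρ / 2 / 2 / 2 ^ (k' + 1)) ∧
        16 * (ρ / 2 / 2 / 2 ^ k) ≤ ρ / 2 / 2 / 2 ^ (k' + 1) ∧ (64 * η ≤ η * 2 ^ a → ∀ e' : Sym2 (Site 2),
        (e' ∈ E.zdABEdges ∨ e' ∈ (shiftData E w).zdABEdges) → η * 2 ^ a - 3 * η ≤ dist (medialPoint E.δ e') q)) ∧
      ((64 * η ≤ η * 2 ^ a ∧ 32 * η ≤ ρ / 2 / 2 / 2 ^ k) →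
        ω ∈ ufrsStrands E w q 3 (7 * η) (min (ρ / 2 / 2 / 2 ^ k / 2) (η * 2 ^ a / 4) - 3 * η)) ∧
      ((64 * η ≤ η * 2 ^ a ∧ ρ / 2 / 2 / 2 ^ k ≤ η * 2 ^ a / 16) →
        ω ∈ ufrsStrands E w q 3 (2 * (ρ / 2 / 2 / 2 ^ k) + 3 * η) (η * 2 ^ a / 4 - 3 * η)) ∧
      (64 * (η * 2 ^ a) ≤ ρ / 2 / 2 / 2 ^ k →
        ω ∈ ufrsStrands E w (medialPoint E.δ e₀) 2 (6 * (η * 2 ^ a)) (ρ / 2 / 2 / 2 ^ k / 2 - 2 * (η * 2 ^ a))) ∧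
      (64 * (η * 2 ^ a) ≤ ρ / 2 / 2 / 2 ^ (k' + 1) → ω ∈ ufrsStrands E w (medialPoint E.δ e₀) 2
        (max (2 * (ρ / 2 / 2 / 2 ^ k)) (4 * (η * 2 ^ a)) + 2 * (η * 2 ^ a)) (ρ / 2 / 2 / 2 ^ (k' + 1) - 2 * (η * 2 ^ a))) ∧
      (64 * (η * 2 ^ a) ≤ ρ → ω ∈ ufrsStrands E w (medialPoint E.δ e₀) 2
        (8 * (ρ / 2 / 2 / 2 ^ (k' + 1)) + 2 * (η * 2 ^ a)) (ρ / 4 - 2 * (η * 2 ^ a)))} := ⟨_, rfl⟩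
  -- positivity of the scales
  have hdpos : ∀ k : ℕ, 0 < ρ / 2 / 2 / 2 ^ k := fun k => by positivity
  have hR'le : ∀ k' : ℕ, ρ / 2 / 2 / 2 ^ (k' + 1) ≤ ρ / 8 := fun k' => by
    rw [div_le_iff₀ (by positivity)]
    have : (2 : ℝ) ≤ 2 ^ (k' + 1) := by
      calc (2 : ℝ) = 2 ^ 1 := (pow_one _).symm
        _ ≤ 2 ^ (k' + 1) := pow_le_pow_right₀ (by norm_num) (by omega)
    nlinarith
  have hUge : ∀ a : ℕ, η ≤ η * 2 ^ a := fun a =>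
    le_mul_of_one_le_right hη.le (one_le_pow₀ (by norm_num))
  -- the grids
  have hN₀η : (N₀ : ℝ) * η ≤ x₁ - x₀ := by
    have := Nat.floor_le (div_nonneg (by linarith : 0 ≤ x₁ - x₀) hη.le)
    rw [← hN₀] at this; rwa [le_div_iff₀ hη] at this
  have hN₁η : (N₁ : ℝ) * η ≤ y₁ - y₀ := by
    have := Nat.floor_le (div_nonneg (by linarith : 0 ≤ y₁ - y₀) hη.le)
    rw [← hN₁] at this; rwa [le_div_iff₀ hη] at this
  have hp₀D : ∀ j < N₀, p₀ j ∈ D.carrier ∧ infDist (p₀ j) D.carrierᶜ ≤ 2 * η := by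
    intro j hj
    have hj' : (j : ℝ) + 1 ≤ N₀ := by exact_mod_cast hj
    have hj'' : ((j : ℝ) + 1) * η ≤ (N₀ : ℝ) * η := mul_le_mul_of_nonneg_right hj' hη.le
    have hj0 : (0 : ℝ) ≤ (j : ℝ) * η := by positivity
    have hmem : p₀ j ∈ Set.Ioo x₀ x₁ ×ℂ Set.Ioo y₀ y₁ := by
      rw [hp₀, Complex.mem_reProdIm, Set.mem_Ioo, Set.mem_Ioo]
      refine ⟨⟨by dsimp only; linarith, by dsimp only; linarith⟩, by dsimp only; linarith, by dsimp only; linarith⟩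
    rw [hD]
    exact ⟨hmem, infDist_compl_le_of_im_W3M _ (Or.inl (by rw [hp₀]; dsimp only; linarith)) hmem⟩
  have hp₁D : ∀ j < N₀, p₁ j ∈ D.carrier ∧ infDist (p₁ j) D.carrierᶜ ≤ 2 * η := by
    intro j hj
    have hj' : (j : ℝ) + 1 ≤ N₀ := by exact_mod_cast hj
    have hj'' : ((j : ℝ) + 1) * η ≤ (N₀ : ℝ) * η := mul_le_mul_of_nonneg_right hj' hη.le
    have hj0 : (0 : ℝ) ≤ (j : ℝ) * η := by positivity
    have hmem : p₁ j ∈ Set.Ioo x₀ x₁ ×ℂ Set.Ioo y₀ y₁ := by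
      rw [hp₁, Complex.mem_reProdIm, Set.mem_Ioo, Set.mem_Ioo]
      refine ⟨⟨by dsimp only; linarith, by dsimp only; linarith⟩, by dsimp only; linarith, by dsimp only; linarith⟩
    rw [hD]
    exact ⟨hmem, infDist_compl_le_of_im_W3M _ (Or.inr (by rw [hp₁]; dsimp only; linarith)) hmem⟩
  have hp₂D : ∀ j < N₁, p₂ j ∈ D.carrier ∧ infDist (p₂ j) D.carrierᶜ ≤ 2 * η := by
    intro j hj
    have hj' : (j : ℝ) + 1 ≤ N₁ := by exact_mod_cast hj
    have hj'' : ((j : ℝ) + 1) * η ≤ (N₁ : ℝ) * η := mul_le_mul_of_nonneg_right hj' hη.le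
    have hj0 : (0 : ℝ) ≤ (j : ℝ) * η := by positivity
    have hmem : p₂ j ∈ Set.Ioo x₀ x₁ ×ℂ Set.Ioo y₀ y₁ := by
      rw [hp₂, Complex.mem_reProdIm, Set.mem_Ioo, Set.mem_Ioo]
      refine ⟨⟨by dsimp only; linarith, by dsimp only; linarith⟩, by dsimp only; linarith, by dsimp only; linarith⟩
    rw [hD]
    exact ⟨hmem, infDist_compl_le_of_re_W3M _ (Or.inl (by rw [hp₂]; dsimp only; linarith)) hmem⟩
  have hp₃D : ∀ j < N₁, p₃ j ∈ D.carrier ∧ infDist (p₃ j) D.carrierᶜ ≤ 2 * η := by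
    intro j hj
    have hj' : (j : ℝ) + 1 ≤ N₁ := by exact_mod_cast hj
    have hj'' : ((j : ℝ) + 1) * η ≤ (N₁ : ℝ) * η := mul_le_mul_of_nonneg_right hj' hη.le
    have hj0 : (0 : ℝ) ≤ (j : ℝ) * η := by positivity
    have hmem : p₃ j ∈ Set.Ioo x₀ x₁ ×ℂ Set.Ioo y₀ y₁ := by
      rw [hp₃, Complex.mem_reProdIm, Set.mem_Ioo, Set.mem_Ioo]
      refine ⟨⟨by dsimp only; linarith, by dsimp only; linarith⟩, by dsimp only; linarith, by dsimp only; linarith⟩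
    rw [hD]
    exact ⟨hmem, infDist_compl_le_of_re_W3M _ (Or.inr (by rw [hp₃]; dsimp only; linarith)) hmem⟩
  have hp₀s : ∀ j j' : ℕ, η * |(j : ℝ) - j'| ≤ dist (p₀ j) (p₀ j') := fun j j' => hgrid_sep_W3M _ _ _ hη.le j j'
  have hp₁s : ∀ j j' : ℕ, η * |(j : ℝ) - j'| ≤ dist (p₁ j) (p₁ j') := fun j j' => hgrid_sep_W3M _ _ _ hη.le j j'
  have hp₂s : ∀ j j' : ℕ, η * |(j : ℝ) - j'| ≤ dist (p₂ j) (p₂ j') := fun j j' => vgrid_sep_W3M _ _ _ hη.le j j'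
  have hp₃s : ∀ j j' : ℕ, η * |(j : ℝ) - j'| ≤ dist (p₃ j) (p₃ j') := fun j j' => vgrid_sep_W3M _ _ _ hη.le j j'
  -- one row
  have hrow : ∀ e₀ ∈ M, ∀ (a k k' : ℕ) (p : ℕ → ℂ) (N : ℕ), (∀ j j' : ℕ, η * |(j : ℝ) - j'| ≤ dist (p j) (p j')) →
      (∀ j < N, p j ∈ D.carrier ∧ infDist (p j) D.carrierᶜ ≤ 2 * η) →
      μ.real (⋃ j ∈ Finset.range N, G e₀ a k k' (p j)) ≤ 11 * K * (η / ρ) ^ min α β := by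
    intro e₀ he₀M a k k' p N hp hpD
    have he₀ := (mem_markedEdges_toFinset_W3M hE w e₀).1 he₀M
    refine le_trans (measureReal_biUnion_finset_le _ _) ?_
    simp only [hG]
    exact markedRow_le_W3M p N hE hδη hT hJ he₀ hp hpD hη (hUge a) (hdpos k) (hdpos (k' + 1)) (hR'le k') hα hβ
  -- four rows
  have hfour : ∀ e₀ ∈ M, ∀ a k k' : ℕ,
      μ.real ((⋃ j ∈ Finset.range N₀, G e₀ a k k' (p₀ j)) ∪ (⋃ j ∈ Finset.range N₀, G e₀ a k k' (p₁ j)) ∪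
        (⋃ j ∈ Finset.range N₁, G e₀ a k k' (p₂ j)) ∪ (⋃ j ∈ Finset.range N₁, G e₀ a k k' (p₃ j))) ≤
      44 * K * (η / ρ) ^ min α β := by
    intro e₀ he₀M a k k'
    have h0 := hrow e₀ he₀M a k k' p₀ N₀ hp₀s hp₀D
    have h1 := hrow e₀ he₀M a k k' p₁ N₀ hp₁s hp₁D
    have h2 := hrow e₀ he₀M a k k' p₂ N₁ hp₂s hp₂D
    have h3 := hrow e₀ he₀M a k k' p₃ N₁ hp₃s hp₃D
    refine le_trans (measureReal_union_le _ _) ?_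
    refine le_trans (add_le_add (measureReal_union_le _ _) le_rfl) ?_
    refine le_trans (add_le_add (add_le_add (measureReal_union_le _ _) le_rfl) le_rfl) ?_
    linarith
  -- the cover
  have hcover : {ω : BondConfig (Site 2) | ∃ z ∈ D.carrier, infDist z D.carrierᶜ < 3 * η ∧ ω ∈ ufrsCertMarked E w z (4 * η) (ρ / 2)} ⊆
      ⋃ e₀ ∈ M, ⋃ a ∈ Finset.range L, ⋃ k ∈ Finset.range L, ⋃ k' ∈ Finset.range L,
        ((⋃ j ∈ Finset.range N₀, G e₀ a k k' (p₀ j)) ∪ (⋃ j ∈ Finset.range N₀, G e₀ a k k' (p₁ j)) ∪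
          (⋃ j ∈ Finset.range N₁, G e₀ a k k' (p₂ j)) ∪ (⋃ j ∈ Finset.range N₁, G e₀ a k k' (p₃ j))) := by
    rintro ω ⟨z, hzD, hzc, hω⟩
    rw [hD] at hzD hzc
    have hzri := (Complex.mem_reProdIm).1 hzD
    rw [mem_ufrsCertMarked_iff] at hω
    obtain ⟨d, R', ⟨k, rfl⟩, ⟨k', rfl⟩, hrd, hdR, hin, hmid, hnb, hout⟩ := hω
    have hdposk : 0 < ρ / 2 / 2 / 2 ^ k := hdpos k
    have hR'le' := hR'le k'
    -- the nearest marked edge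
    rw [mem_ufrsMarkedNbhd_iff] at hnb
    obtain ⟨e₁, he₁, hd₁⟩ := hnb
    have hMne : M.Nonempty := ⟨e₁, (mem_markedEdges_toFinset_W3M hE w e₁).2 he₁⟩
    obtain ⟨e₀, he₀M, hmin⟩ := Finset.exists_min_image M (fun e => dist (medialPoint E.δ e) z) hMne
    obtain ⟨u, hu⟩ : ∃ u : ℝ, u = dist (medialPoint E.δ e₀) z := ⟨_, rfl⟩
    have hmin' : ∀ e' ∈ M, u ≤ dist (medialPoint E.δ e') z := fun e' he' => by rw [hu]; exact hmin e' he'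
    have hu0 : 0 ≤ u := by rw [hu]; exact dist_nonneg
    have hu4 : u ≤ 4 * (ρ / 2 / 2 / 2 ^ (k' + 1)) :=
      le_trans (hmin' e₁ ((mem_markedEdges_toFinset_W3M hE w e₁).2 he₁)) hd₁
    -- the dyadic class of `u`
    obtain ⟨n, hn⟩ : ∃ n : ℕ, n = ⌊u / η⌋₊ := ⟨_, rfl⟩
    obtain ⟨a, ha⟩ : ∃ a : ℕ, a = Nat.log 2 n := ⟨_, rfl⟩
    have hnle : (n : ℝ) ≤ u / η := by rw [hn]; exact Nat.floor_le (div_nonneg hu0 hη.le)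
    have hnlt : u / η < n + 1 := by rw [hn]; exact Nat.lt_floor_add_one _
    have hn2 : n < 2 ^ (a + 1) := by rw [ha]; exact Nat.lt_pow_succ_log_self (by norm_num) n
    have hu2U : u < 2 * (η * 2 ^ a) := by
      have h1 : (n : ℝ) + 1 ≤ 2 ^ (a + 1) := by exact_mod_cast hn2
      rw [pow_succ] at h1
      rw [div_lt_iff₀ hη] at hnlt
      have h2 : ((n : ℝ) + 1) * η ≤ 2 ^ a * 2 * η := mul_le_mul_of_nonneg_right h1 hη.le
      linarith
    have hUu : n ≠ 0 → η * 2 ^ a ≤ u := by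
      intro hn0
      have h1 : ((2 ^ a : ℕ) : ℝ) ≤ n := by rw [ha]; exact_mod_cast Nat.pow_log_le_self 2 hn0
      push_cast at h1
      rw [le_div_iff₀ hη] at hnle
      have h2 : (2 : ℝ) ^ a * η ≤ (n : ℝ) * η := mul_le_mul_of_nonneg_right h1 hη.le
      linarith
    have ha0 : n = 0 → a = 0 := fun hn0 => by rw [ha, hn0, Nat.log_zero_right]
    have hU64 : 64 * η ≤ η * 2 ^ a → η * 2 ^ a ≤ u := by
      intro h64
      refine hUu fun hn0 => ?_
      rw [ha0 hn0, pow_zero, mul_one] at h64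
      linarith
    have hU4R : η * 2 ^ a ≤ 4 * (ρ / 2 / 2 / 2 ^ (k' + 1)) := by
      rcases Nat.eq_zero_or_pos n with hn0 | hnpos
      · rw [ha0 hn0, pow_zero, mul_one]
        linarith
      · exact le_trans (hUu (Nat.pos_iff_ne_zero.1 hnpos)) hu4
    -- the indices are below `L`
    have haL : a < L := by
      refine lt_logCeil_W3M a ?_
      rw [le_div_iff₀ hη]
      rcases Nat.eq_zero_or_pos n with hn0 | hnpos
      · rw [ha0 hn0, pow_zero]; linarith
      · have := hUu (Nat.pos_iff_ne_zero.1 hnpos); linarith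
    have hkL : k < L := by
      refine lt_logCeil_W3M k ?_
      rw [le_div_iff₀ hη]
      have h1 : 4 * η * 2 ^ k ≤ ρ / 2 / 2 := by
        rw [le_div_iff₀ (by positivity)] at hrd; linarith
      linarith
    have hk'L : k' < L := by
      refine lt_logCeil_W3M k' ?_
      rw [le_div_iff₀ hη]
      have h1 : 64 * η ≤ ρ / 2 / 2 / 2 ^ (k' + 1) := by linarith
      rw [le_div_iff₀ (by positivity), pow_succ] at h1
      linarith
    -- membership in the per-box event at any box centre within `3η` of `z`
    have hzm : dist z (medialPoint E.δ e₀) ≤ 2 * (η * 2 ^ a) := by rw [dist_comm, ← hu]; exact hu2U.le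
    have hGmem : ∀ q : ℂ, dist z q ≤ 3 * η → ω ∈ G e₀ a k k' q := by
      intro q hzq
      have hqz : dist q z ≤ 3 * η := by rw [dist_comm]; exact hzq
      have he₀ := (mem_markedEdges_toFinset_W3M hE w e₀).1 he₀M
      have hηU := hUge a
      rw [hG]
      simp only [Set.mem_setOf_eq]
      refine ⟨⟨?_, hU4R, hdR, fun h64 e' he' => ?_⟩, fun hg => ?_, fun hg => ?_, fun h => ?_, fun h => ?_, fun h => ?_⟩
      · have := dist_triangle q z (medialPoint E.δ e₀)
        linarith only [this, hqz, hzm]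
      · have h1 := hmin' e' ((mem_markedEdges_toFinset_W3M hE w e').2 he')
        have h2 := dist_triangle (medialPoint E.δ e') q z
        have h3 := hU64 h64
        linarith only [h1, h2, h3, hqz]
      · have h8 : 2 * (4 * η) ≤ ρ / 2 / 2 / 2 ^ k := by linarith only [hg.2, hη]
        have hm := min_le_left (ρ / 2 / 2 / 2 ^ k / 2) (η * 2 ^ a / 4)
        exact ufrsStrands_mono_W3M E w 3 hzq (by linarith only []) (by linarith only [hm]) (hin h8)
      · have h1 := hU64 hg.1
        exact ufrsStrands_mono_W3M E w 3 hzq (by linarith only []) (by linarith only [h1, hu4]) hmid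
      · have h8 : 2 * (4 * η) ≤ ρ / 2 / 2 / 2 ^ k := by linarith only [h, hηU, hη]
        exact ufrsStrands_mono_W3M E w 2 hzm (by linarith only [hηU]) (by linarith only [])
          (ufrsStrands_two_of_three_W3M E w z _ _ (hin h8))
      · have hm := le_max_left (2 * (ρ / 2 / 2 / 2 ^ k)) (4 * (η * 2 ^ a))
        exact ufrsStrands_mono_W3M E w 2 hzm (by linarith only [hm]) (by linarith only [])
          (ufrsStrands_two_of_three_W3M E w z _ _ hmid)
      · exact ufrsStrands_mono_W3M E w 2 hzm (by linarith only []) (by linarith only []) hout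
    -- the box of `z`
    have hbox : ∃ q : ℂ, dist z q ≤ 3 * η ∧ ((∃ j < N₀, q = p₀ j) ∨ (∃ j < N₀, q = p₁ j) ∨ (∃ j < N₁, q = p₂ j) ∨ (∃ j < N₁, q = p₃ j)) := by
      rcases near_side_W3M hzc with h | h | h | h
      · obtain ⟨j, hj, hjx⟩ := grid_index_W3M hη (by linarith only [hηx, hη]) hzri.1.1 hzri.1.2
        refine ⟨p₀ j, ?_, Or.inl ⟨j, hj, rfl⟩⟩
        refine le_trans (dist_le_re_add_im'_W3M _ _) ?_
        rw [hp₀]; dsimp only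
        have : |z.im - (y₀ + 3 * η / 2)| ≤ 3 * η / 2 := abs_le.2 ⟨by linarith only [hzri.2.1], by linarith only [h, hη]⟩
        linarith only [this, hjx]
      · obtain ⟨j, hj, hjx⟩ := grid_index_W3M hη (by linarith only [hηx, hη]) hzri.1.1 hzri.1.2
        refine ⟨p₁ j, ?_, Or.inr (Or.inl ⟨j, hj, rfl⟩)⟩
        refine le_trans (dist_le_re_add_im'_W3M _ _) ?_
        rw [hp₁]; dsimp only
        have : |z.im - (y₁ - 3 * η / 2)| ≤ 3 * η / 2 := abs_le.2 ⟨by linarith only [h, hη], by linarith only [hzri.2.2]⟩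
        linarith only [this, hjx]
      · obtain ⟨j, hj, hjy⟩ := grid_index_W3M hη (by linarith only [hηy, hη]) hzri.2.1 hzri.2.2
        refine ⟨p₂ j, ?_, Or.inr (Or.inr (Or.inl ⟨j, hj, rfl⟩))⟩
        refine le_trans (dist_le_re_add_im'_W3M _ _) ?_
        rw [hp₂]; dsimp only
        have : |z.re - (x₀ + 3 * η / 2)| ≤ 3 * η / 2 := abs_le.2 ⟨by linarith only [hzri.1.1], by linarith only [h, hη]⟩
        linarith only [this, hjy]
      · obtain ⟨j, hj, hjy⟩ := grid_index_W3M hη (by linarith only [hηy, hη]) hzri.2.1 hzri.2.2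
        refine ⟨p₃ j, ?_, Or.inr (Or.inr (Or.inr ⟨j, hj, rfl⟩))⟩
        refine le_trans (dist_le_re_add_im'_W3M _ _) ?_
        rw [hp₃]; dsimp only
        have : |z.re - (x₁ - 3 * η / 2)| ≤ 3 * η / 2 := abs_le.2 ⟨by linarith only [h, hη], by linarith only [hzri.1.2]⟩
        linarith only [this, hjy]
    obtain ⟨q, hzq, hq⟩ := hbox
    have hωG := hGmem q hzq
    refine Set.mem_iUnion₂.2 ⟨e₀, he₀M, Set.mem_iUnion₂.2 ⟨a, Finset.mem_range.2 haL,
      Set.mem_iUnion₂.2 ⟨k, Finset.mem_range.2 hkL, Set.mem_iUnion₂.2 ⟨k', Finset.mem_range.2 hk'L, ?_⟩⟩⟩⟩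
    rcases hq with ⟨j, hj, rfl⟩ | ⟨j, hj, rfl⟩ | ⟨j, hj, rfl⟩ | ⟨j, hj, rfl⟩
    · exact Or.inl (Or.inl (Or.inl (Set.mem_iUnion₂.2 ⟨j, Finset.mem_range.2 hj, hωG⟩)))
    · exact Or.inl (Or.inl (Or.inr (Set.mem_iUnion₂.2 ⟨j, Finset.mem_range.2 hj, hωG⟩)))
    · exact Or.inl (Or.inr (Set.mem_iUnion₂.2 ⟨j, Finset.mem_range.2 hj, hωG⟩))
    · exact Or.inr (Set.mem_iUnion₂.2 ⟨j, Finset.mem_range.2 hj, hωG⟩)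
  -- summation
  have hcard : (M.card : ℝ) ≤ 4 := by exact_mod_cast card_markedEdges_le_W3M hE w
  calc μ.real {ω : BondConfig (Site 2) | ∃ z ∈ D.carrier, infDist z D.carrierᶜ < 3 * η ∧ ω ∈ ufrsCertMarked E w z (4 * η) (ρ / 2)}
      ≤ μ.real (⋃ e₀ ∈ M, ⋃ a ∈ Finset.range L, ⋃ k ∈ Finset.range L, ⋃ k' ∈ Finset.range L,
        ((⋃ j ∈ Finset.range N₀, G e₀ a k k' (p₀ j)) ∪ (⋃ j ∈ Finset.range N₀, G e₀ a k k' (p₁ j)) ∪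
          (⋃ j ∈ Finset.range N₁, G e₀ a k k' (p₂ j)) ∪ (⋃ j ∈ Finset.range N₁, G e₀ a k k' (p₃ j)))) :=
        measureReal_mono hcover (measure_ne_top _ _)
    _ ≤ ∑ e₀ ∈ M, ∑ a ∈ Finset.range L, ∑ k ∈ Finset.range L, ∑ k' ∈ Finset.range L,
        μ.real ((⋃ j ∈ Finset.range N₀, G e₀ a k k' (p₀ j)) ∪ (⋃ j ∈ Finset.range N₀, G e₀ a k k' (p₁ j)) ∪
          (⋃ j ∈ Finset.range N₁, G e₀ a k k' (p₂ j)) ∪ (⋃ j ∈ Finset.range N₁, G e₀ a k k' (p₃ j))) := by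
        refine le_trans (measureReal_biUnion_finset_le _ _) (Finset.sum_le_sum fun e₀ _ => ?_)
        refine le_trans (measureReal_biUnion_finset_le _ _) (Finset.sum_le_sum fun a _ => ?_)
        refine le_trans (measureReal_biUnion_finset_le _ _) (Finset.sum_le_sum fun k _ => ?_)
        exact measureReal_biUnion_finset_le _ _
    _ ≤ ∑ e₀ ∈ M, ∑ _a ∈ Finset.range L, ∑ _k ∈ Finset.range L, ∑ _k' ∈ Finset.range L, 44 * K * (η / ρ) ^ min α β := by
        refine Finset.sum_le_sum fun e₀ he₀ => Finset.sum_le_sum fun a _ => Finset.sum_le_sum fun k _ =>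
          Finset.sum_le_sum fun k' _ => hfour e₀ he₀ a k k'
    _ = (M.card : ℝ) * ((L : ℝ) * ((L : ℝ) * ((L : ℝ) * (44 * K * (η / ρ) ^ min α β)))) := by
        rw [Finset.sum_const, Finset.sum_const, Finset.sum_const, Finset.sum_const, Finset.card_range,
          nsmul_eq_mul, nsmul_eq_mul, nsmul_eq_mul, nsmul_eq_mul]
    _ ≤ 4 * ((L : ℝ) * ((L : ℝ) * ((L : ℝ) * (44 * K * (η / ρ) ^ min α β)))) :=
        mul_le_mul_of_nonneg_right hcard (by positivity)
    _ = 176 * K * (L : ℝ) ^ 3 * (η / ρ) ^ min α β := by ring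

/-- The dyadic scale count, closed form (registered anchor `ufrs_lt_logCeil`; re-landing of this
module to re-enqueue its farm build, lead c5): if `2 ^ t ≤ ρ / η` then `t < Nat.log 2 ⌈ρ/η⌉₊ + 1`. -/
theorem ufrs_lt_logCeil : ∀ (ρ η : ℝ) (t : ℕ), (2 : ℝ) ^ t ≤ ρ / η → t < Nat.log 2 ⌈ρ / η⌉₊ + 1 :=
  fun _ _ t h => lt_logCeil_W3M t h

end

end Summit.CriticalPhenomena.CardyFormulaZ2.Cruxes.EdgePrecompact.QkzStripBoundaryArm
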